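import Literature.Analysis.FluidPDE.TorusNSGevreyCoefficients
import Literature.Analysis.FluidPDE.TorusLinearisedNSGevreyLattice
import Literature.Analysis.FunctionSpaces.TorusGevreySobolevBounds
import Literature.Analysis.FunctionSpaces.TorusGevreyCompactness
import Literature.Analysis.FunctionSpaces.TorusLerayHelmholtzH1
import HarnessLib

/-!
# Gevrey balls of `T^d` are stable under the operations of the Navier–Stokes vector field

Analysis/FluidPDE proof file (theorems only; no definitions, no named facts). A **Gevrey bound** of
radius `σ` and level `C` on a coefficient family `c : ℤ^d → V` is the family of inequalities
`∑_{k ∈ S} e^{2σ|k|} ‖c k‖² ≤ C` over all finite `S ⊆ ℤ^d` (the balls of the classes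
`D(e^{σ A^{1/2}})` of Foias–Temam 1989, written on the Fourier side as everywhere in the tree:
`TorusGevreySobolevBounds`, `TorusGevreyInterpolation`, `TorusNSGevreyBootstrap`). This file proves
the elementary **algebra** of such bounds needed to see that the Navier–Stokes vector field
`G(u) = νΔu − P((u·∇)u) + f` and its linearisation map Gevrey balls into Gevrey balls (of half the
radius):

* `Torus.gevreyBound_mono_radius`, `Torus.gevreyBound_of_norm_le`, `Torus.gevreyBound_of_norm_le_add`,
  `Torus.gevreyBound_of_eq_zero_off` — monotonicity in the radius, domination, sums, finitely supported
  spectra (trigonometric polynomials);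
* `Torus.gevreyBound_of_norm_le_weight_mul` — **Gevrey beats polynomial weights**: a family dominated by
  `L (1 + |k|²)^m ‖c k‖` obeys a Gevrey bound at radius `σ/2` (`(1 + |k|²)^{2m} e^{−σ|k|} ≤ (4m)! σ^{−4m} e^{σ}`,
  `Torus.one_add_sq_pow_mul_exp_neg_le`); whence `Torus.gevreyBound_laplacian` (`𝓕(Δv) = −4π²|k|² v̂`);
* `Torus.norm_mFourierCoeff_leray_le` — the Leray–Helmholtz correction `P v = v − ∇Δ⁻¹div v` is a
  contraction on every Fourier mode, `‖𝓕(P v)(k)‖ ≤ ‖v̂(k)‖` (`v̂ = 𝓕(Pv) + 𝓕(∇φ)` is an orthogonal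
  decomposition in `ℂ^d`: `NSGevrey.inner_mFourierCoeff_gradient_eq_zero`, Robinson–Rodrigo–Sadowski 2016,
  Lemma 2.9), whence `Torus.gevreyBound_leray`;
* `Torus.gevreyBound_convect` — **the product law**: if `u`, `v` obey Gevrey bounds of radius `σ` then
  `(u·∇)v` obeys one of radius `σ/2` with level `(2π d² · 2√C_u Z · 2√C_v Z)²`,
  `Z = ∑ₘ (1 + |m|²) e^{−(σ/2)|m|}`: the convective coefficients are dominated by the lattice convolution
  `2π d² ∑ₘ ‖û(m)‖ |k − m| ‖v̂(k − m)‖` (`NSGevrey.norm_mFourierCoeff_convect_le`), the weight splits as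
  `e^{(σ/2)|k|} ≤ e^{(σ/2)|m|} e^{(σ/2)|k − m|}`, and Young `ℓ¹ ⋆ ℓ² ⊂ ℓ²` in the duality form
  `NSGevrey.sum_mul_tsum_mul_le` closes with the weighted `ℓ¹` bounds at half radius
  `NSGevrey.summable_exp_mul_one_add_sqrt_mul_norm_of_gevreyBound` (Foias–Temam 1989, Lemma 2.1;
  Ferrari–Titi 1998, Lemma 1: Gevrey classes are Banach algebras).

## Mathlib / tree search

Tree (reused): the files quoted above and `Torus.mFourierCoeff_complexify_laplacian`,
`Torus.mFourierCoeff_add`, `Torus.gevreyBound_nonneg`, `NSGevrey.sqrt_freqNormSq_add_le`,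
`NSGevrey.le_sqrt_tsum_sq`. Searched `gevreyBound_convect`, `Gevrey.*algebra`, `leray_le.*mFourierCoeff`,
`norm_mFourierCoeff_sub_gradient`: nothing in the tree; Mathlib has no Gevrey classes.

## References

* C. Foias, R. Temam, *Gevrey class regularity for the solutions of the Navier–Stokes equations*,
  J. Funct. Anal. 87 (1989) 359–369, Lemma 2.1. [FoiasTemam1989]
* J. C. Robinson, J. L. Rodrigo, W. Sadowski, *The Three-Dimensional Navier–Stokes Equations*, CUP 2016,
  Lemma 2.9, Thm. 2.6. [RobinsonRodrigoSadowskiCUP2016]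
-/

noncomputable section

open _root_.MeasureTheory Set Filter Function UnitAddTorus Finset
open scoped Topology BigOperators InnerProductSpace

namespace Literature.Analysis.FluidPDE

namespace Torus

open Literature.Analysis.FunctionSpaces Literature.Analysis.FunctionSpaces.Torus NSGevrey

variable {d : Type*} [Fintype d]

/-! ### Elementary algebra of Gevrey bounds on coefficient families -/

section Families

variable {V W : Type*} [NormedAddCommGroup V] [NormedAddCommGroup W] {σ : ℝ}

/-- **Monotonicity in the radius**: a Gevrey bound of radius `σ` is a Gevrey bound of every radius
`σ' ≤ σ` with the same level. [folklore] -/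
theorem gevreyBound_mono_radius {σ' C : ℝ} {c : (d → ℤ) → V} (hσ' : σ' ≤ σ)
    (h : ∀ S : Finset (d → ℤ), ∑ k ∈ S, Real.exp (2 * σ * Real.sqrt (freqNormSq k)) * ‖c k‖ ^ 2 ≤ C)
    (S : Finset (d → ℤ)) : ∑ k ∈ S, Real.exp (2 * σ' * Real.sqrt (freqNormSq k)) * ‖c k‖ ^ 2 ≤ C := by
  refine (Finset.sum_le_sum fun k _ => ?_).trans (h S)
  refine mul_le_mul_of_nonneg_right (Real.exp_le_exp.2 ?_) (sq_nonneg _)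
  exact mul_le_mul_of_nonneg_right (mul_le_mul_of_nonneg_left hσ' zero_le_two) (Real.sqrt_nonneg _)

/-- **Domination**: a family dominated modewise by a family with a Gevrey bound has the same Gevrey
bound. [folklore] -/
theorem gevreyBound_of_norm_le {C : ℝ} {c : (d → ℤ) → V} {b : (d → ℤ) → W} (hb : ∀ k, ‖b k‖ ≤ ‖c k‖)
    (h : ∀ S : Finset (d → ℤ), ∑ k ∈ S, Real.exp (2 * σ * Real.sqrt (freqNormSq k)) * ‖c k‖ ^ 2 ≤ C)
    (S : Finset (d → ℤ)) : ∑ k ∈ S, Real.exp (2 * σ * Real.sqrt (freqNormSq k)) * ‖b k‖ ^ 2 ≤ C := by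
  refine (Finset.sum_le_sum fun k _ => ?_).trans (h S)
  exact mul_le_mul_of_nonneg_left (pow_le_pow_left₀ (norm_nonneg _) (hb k) 2) (Real.exp_pos _).le

/-- **Sums**: a family dominated modewise by `‖c₁ k‖ + ‖c₂ k‖`, where `c₁`, `c₂` have Gevrey bounds of
levels `C₁`, `C₂` (same radius), has the Gevrey bound `2C₁ + 2C₂` (`(x + y)² ≤ 2x² + 2y²`). [folklore] -/
theorem gevreyBound_of_norm_le_add {U : Type*} [NormedAddCommGroup U] {C₁ C₂ : ℝ} {c₁ : (d → ℤ) → V}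
    {c₂ : (d → ℤ) → W} {b : (d → ℤ) → U} (hb : ∀ k, ‖b k‖ ≤ ‖c₁ k‖ + ‖c₂ k‖)
    (h₁ : ∀ S : Finset (d → ℤ), ∑ k ∈ S, Real.exp (2 * σ * Real.sqrt (freqNormSq k)) * ‖c₁ k‖ ^ 2 ≤ C₁)
    (h₂ : ∀ S : Finset (d → ℤ), ∑ k ∈ S, Real.exp (2 * σ * Real.sqrt (freqNormSq k)) * ‖c₂ k‖ ^ 2 ≤ C₂)
    (S : Finset (d → ℤ)) :
    ∑ k ∈ S, Real.exp (2 * σ * Real.sqrt (freqNormSq k)) * ‖b k‖ ^ 2 ≤ 2 * C₁ + 2 * C₂ := by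
  have hpt : ∀ k, Real.exp (2 * σ * Real.sqrt (freqNormSq k)) * ‖b k‖ ^ 2 ≤
      2 * (Real.exp (2 * σ * Real.sqrt (freqNormSq k)) * ‖c₁ k‖ ^ 2) +
        2 * (Real.exp (2 * σ * Real.sqrt (freqNormSq k)) * ‖c₂ k‖ ^ 2) := by
    intro k
    have he : 0 ≤ Real.exp (2 * σ * Real.sqrt (freqNormSq k)) := (Real.exp_pos _).le
    have hsq : ‖b k‖ ^ 2 ≤ 2 * ‖c₁ k‖ ^ 2 + 2 * ‖c₂ k‖ ^ 2 := by
      nlinarith [hb k, norm_nonneg (b k), norm_nonneg (c₁ k), norm_nonneg (c₂ k),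
        sq_nonneg (‖c₁ k‖ - ‖c₂ k‖)]
    nlinarith [mul_le_mul_of_nonneg_left hsq he]
  calc ∑ k ∈ S, Real.exp (2 * σ * Real.sqrt (freqNormSq k)) * ‖b k‖ ^ 2
      ≤ ∑ k ∈ S, (2 * (Real.exp (2 * σ * Real.sqrt (freqNormSq k)) * ‖c₁ k‖ ^ 2) +
          2 * (Real.exp (2 * σ * Real.sqrt (freqNormSq k)) * ‖c₂ k‖ ^ 2)) := Finset.sum_le_sum fun k _ => hpt k
    _ = 2 * ∑ k ∈ S, Real.exp (2 * σ * Real.sqrt (freqNormSq k)) * ‖c₁ k‖ ^ 2 +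
          2 * ∑ k ∈ S, Real.exp (2 * σ * Real.sqrt (freqNormSq k)) * ‖c₂ k‖ ^ 2 := by
        rw [Finset.sum_add_distrib, Finset.mul_sum, Finset.mul_sum]
    _ ≤ 2 * C₁ + 2 * C₂ := by linarith [h₁ S, h₂ S]

/-- **Finitely supported spectra** (trigonometric polynomials): a family vanishing off a finite set `T`
has, at every radius `σ`, the Gevrey bound `∑_{k ∈ T} e^{2σ|k|} ‖c k‖²`. [folklore] -/
theorem gevreyBound_of_eq_zero_off [DecidableEq d] (T : Finset (d → ℤ)) {c : (d → ℤ) → V}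
    (hc : ∀ k, k ∉ T → c k = 0) (S : Finset (d → ℤ)) :
    ∑ k ∈ S, Real.exp (2 * σ * Real.sqrt (freqNormSq k)) * ‖c k‖ ^ 2 ≤
      ∑ k ∈ T, Real.exp (2 * σ * Real.sqrt (freqNormSq k)) * ‖c k‖ ^ 2 := by
  have h0 : ∀ k, 0 ≤ Real.exp (2 * σ * Real.sqrt (freqNormSq k)) * ‖c k‖ ^ 2 := fun k =>
    mul_nonneg (Real.exp_pos _).le (sq_nonneg _)
  calc ∑ k ∈ S, Real.exp (2 * σ * Real.sqrt (freqNormSq k)) * ‖c k‖ ^ 2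
      = ∑ k ∈ S ∩ T, Real.exp (2 * σ * Real.sqrt (freqNormSq k)) * ‖c k‖ ^ 2 :=
        (Finset.sum_subset Finset.inter_subset_left fun k hkS hknot => by
          rw [hc k fun hkT => hknot (Finset.mem_inter.2 ⟨hkS, hkT⟩), norm_zero]
          ring).symm
    _ ≤ ∑ k ∈ T, Real.exp (2 * σ * Real.sqrt (freqNormSq k)) * ‖c k‖ ^ 2 :=
        Finset.sum_le_sum_of_subset_of_nonneg Finset.inter_subset_right fun k _ _ => h0 k

/-- **Gevrey beats polynomial weights** (Foias–Temam 1989 Gevrey classes; the elementary half of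
"`D(e^{σA^{1/2}}) ⊂ D(A^m e^{(σ/2)A^{1/2}})`"): if `‖b k‖ ≤ L (1 + |k|²)^m ‖c k‖` for all `k`
and `c` has a Gevrey bound of radius `σ > 0` and level `C`, then `b` has the Gevrey bound of radius
`σ/2` and level `L² · ((4m)! σ^{−4m} e^{σ}) · C`, because
`e^{σ|k|} (1 + |k|²)^{2m} = e^{2σ|k|} · (1 + |k|²)^{2m} e^{−σ|k|}` and
`(1 + |k|²)^{2m} e^{−σ|k|} ≤ (4m)! σ^{−4m} e^{σ}` (`Torus.one_add_sq_pow_mul_exp_neg_le`). [folklore] -/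
theorem gevreyBound_of_norm_le_weight_mul {C L : ℝ} {m : ℕ} {c : (d → ℤ) → V} {b : (d → ℤ) → W}
    (hσ : 0 < σ) (hb : ∀ k, ‖b k‖ ≤ L * (1 + freqNormSq k) ^ m * ‖c k‖)
    (h : ∀ S : Finset (d → ℤ), ∑ k ∈ S, Real.exp (2 * σ * Real.sqrt (freqNormSq k)) * ‖c k‖ ^ 2 ≤ C)
    (S : Finset (d → ℤ)) :
    ∑ k ∈ S, Real.exp (2 * (σ / 2) * Real.sqrt (freqNormSq k)) * ‖b k‖ ^ 2 ≤
      L ^ 2 * ((2 * (2 * m)).factorial / σ ^ (2 * (2 * m)) * Real.exp σ) * C := by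
  set K : ℝ := (2 * (2 * m)).factorial / σ ^ (2 * (2 * m)) * Real.exp σ with hK
  have hK0 : 0 ≤ K := by positivity
  have hpt : ∀ k, Real.exp (2 * (σ / 2) * Real.sqrt (freqNormSq k)) * ‖b k‖ ^ 2 ≤
      L ^ 2 * K * (Real.exp (2 * σ * Real.sqrt (freqNormSq k)) * ‖c k‖ ^ 2) := by
    intro k
    set t : ℝ := Real.sqrt (freqNormSq k) with ht
    have ht0 : 0 ≤ t := Real.sqrt_nonneg _
    have htt : t ^ 2 = freqNormSq k := Real.sq_sqrt (freqNormSq_nonneg k)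
    have hw : (1 + freqNormSq k) ^ (2 * m) * Real.exp (-(σ * t)) ≤ K := by
      rw [← htt]; exact one_add_sq_pow_mul_exp_neg_le hσ (2 * m) ht0
    have hw0 : 0 ≤ (1 + freqNormSq k) ^ m := one_add_freqNormSq_pow_nonneg k m
    have hb2 : ‖b k‖ ^ 2 ≤ (L * (1 + freqNormSq k) ^ m * ‖c k‖) ^ 2 :=
      pow_le_pow_left₀ (norm_nonneg _) (hb k) 2
    have hexp : Real.exp (2 * (σ / 2) * t) = Real.exp (2 * σ * t) * Real.exp (-(σ * t)) := by
      rw [← Real.exp_add]; congr 1; ring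
    calc Real.exp (2 * (σ / 2) * t) * ‖b k‖ ^ 2
        ≤ Real.exp (2 * (σ / 2) * t) * (L * (1 + freqNormSq k) ^ m * ‖c k‖) ^ 2 :=
          mul_le_mul_of_nonneg_left hb2 (Real.exp_pos _).le
      _ = L ^ 2 * ((1 + freqNormSq k) ^ (2 * m) * Real.exp (-(σ * t))) *
            (Real.exp (2 * σ * t) * ‖c k‖ ^ 2) := by rw [hexp]; ring
      _ ≤ L ^ 2 * K * (Real.exp (2 * σ * t) * ‖c k‖ ^ 2) :=
          mul_le_mul_of_nonneg_right (mul_le_mul_of_nonneg_left hw (sq_nonneg L))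
            (mul_nonneg (Real.exp_pos _).le (sq_nonneg _))
  calc ∑ k ∈ S, Real.exp (2 * (σ / 2) * Real.sqrt (freqNormSq k)) * ‖b k‖ ^ 2
      ≤ ∑ k ∈ S, L ^ 2 * K * (Real.exp (2 * σ * Real.sqrt (freqNormSq k)) * ‖c k‖ ^ 2) :=
        Finset.sum_le_sum fun k _ => hpt k
    _ = L ^ 2 * K * ∑ k ∈ S, Real.exp (2 * σ * Real.sqrt (freqNormSq k)) * ‖c k‖ ^ 2 := by rw [Finset.mul_sum]
    _ ≤ L ^ 2 * K * C := mul_le_mul_of_nonneg_left (h S) (by positivity)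

end Families

/-! ### The Laplacian and the Leray–Helmholtz correction -/

section Operators

variable [DecidableEq d] {σ C : ℝ} {v : UnitAddTorus d → EuclideanSpace ℝ d}

/-- **The Laplacian on a Gevrey ball**: if `v̂` has a Gevrey bound of radius `σ > 0` and level `C` then
`𝓕(Δv)` has the Gevrey bound of radius `σ/2` and level `(4π²)² · (4! σ^{−4} e^{σ}) · C`
(`‖𝓕(Δv)(k)‖ ≤ 4π² (1 + |k|²) ‖v̂(k)‖`, `Torus.norm_mFourierCoeff_complexify_laplacian_le`). [folklore] -/
theorem gevreyBound_laplacian (hσ : 0 < σ) (hv : IsSmooth v)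
    (h : ∀ S : Finset (d → ℤ), ∑ k ∈ S, Real.exp (2 * σ * Real.sqrt (freqNormSq k)) *
      ‖mFourierCoeff (EuclideanSpace.complexify ∘ v) k‖ ^ 2 ≤ C) (S : Finset (d → ℤ)) :
    ∑ k ∈ S, Real.exp (2 * (σ / 2) * Real.sqrt (freqNormSq k)) *
        ‖mFourierCoeff (EuclideanSpace.complexify ∘ laplacian v) k‖ ^ 2 ≤
      (4 * Real.pi ^ 2) ^ 2 * ((2 * (2 * 1)).factorial / σ ^ (2 * (2 * 1)) * Real.exp σ) * C :=
  gevreyBound_of_norm_le_weight_mul (m := 1) hσ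
    (fun k => by rw [pow_one]; exact norm_mFourierCoeff_complexify_laplacian_le hv k) h S

/-- **The Leray–Helmholtz correction is a contraction on every Fourier mode**: for smooth `v` on `T^d`
(`d` nonempty), `‖𝓕(v − ∇Δ⁻¹div v)(k)‖ ≤ ‖v̂(k)‖`. Indeed `v = Pv + ∇φ` with `φ = Δ⁻¹div v` and `Pv`
smooth and divergence free, so modewise `v̂(k) = 𝓕(Pv)(k) + 𝓕(∇φ)(k)` with
`⟪𝓕(∇φ)(k), 𝓕(Pv)(k)⟫_ℂ = 0` (`NSGevrey.inner_mFourierCoeff_gradient_eq_zero`), and Pythagoras in `ℂ^d`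
(Robinson–Rodrigo–Sadowski 2016, Lemma 2.9: the symbol of `ℙ` is the orthogonal projection onto `k^⊥`).
[cite: RobinsonRodrigoSadowskiCUP2016, Lemma 2.9] -/
theorem norm_mFourierCoeff_leray_le [Nonempty d] (hv : IsSmooth v) (k : d → ℤ) :
    ‖mFourierCoeff (EuclideanSpace.complexify ∘ fun x => v x - Torus.gradient (invLaplacian (divergence v)) x) k‖ ≤
      ‖mFourierCoeff (EuclideanSpace.complexify ∘ v) k‖ := by
  set φ : UnitAddTorus d → ℝ := invLaplacian (divergence v) with hφ
  have hφs : IsSmooth φ := isSmooth_invLaplacian hv.divergence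
  have hP : IsSmooth (fun x => v x - Torus.gradient φ x) := isSmooth_sub_gradient_invLaplacian_divergence hv
  have hPdiv : IsDivFree (fun x => v x - Torus.gradient φ x) :=
    isDivFree_sub_gradient_invLaplacian_divergence hv
  set a := mFourierCoeff (EuclideanSpace.complexify ∘ fun x => v x - Torus.gradient φ x) k with ha
  set b := mFourierCoeff (EuclideanSpace.complexify ∘ Torus.gradient φ) k with hb
  -- `v̂(k) = a + b`
  have hsum : mFourierCoeff (EuclideanSpace.complexify ∘ v) k = a + b := by
    have hfun : (EuclideanSpace.complexify ∘ v) =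
        (EuclideanSpace.complexify ∘ fun x => v x - Torus.gradient φ x) +
          (EuclideanSpace.complexify ∘ Torus.gradient φ) := by
      funext x
      simp only [Function.comp_apply, Pi.add_apply, ← map_add, sub_add_cancel]
    rw [hfun, mFourierCoeff_add (integrable_complexify_comp hP.integrable)
      (integrable_complexify_comp hφs.gradient.integrable)]
  -- orthogonality and Pythagoras
  have horth : inner ℂ b a = 0 := inner_mFourierCoeff_gradient_eq_zero hφs hP hPdiv k
  have horth' : inner ℂ a b = 0 := by rw [← inner_conj_symm, horth, map_zero]
  have hpy : ‖a + b‖ * ‖a + b‖ = ‖a‖ * ‖a‖ + ‖b‖ * ‖b‖ :=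
    norm_add_sq_eq_norm_sq_add_norm_sq_of_inner_eq_zero a b horth'
  rw [hsum]
  nlinarith [norm_nonneg (a + b), norm_nonneg a, norm_nonneg b]

/-- **The Leray–Helmholtz correction on a Gevrey ball**: `𝓕(v − ∇Δ⁻¹div v)` inherits every Gevrey bound
of `v̂` (`Torus.norm_mFourierCoeff_leray_le`). [folklore] -/
theorem gevreyBound_leray [Nonempty d] (hv : IsSmooth v)
    (h : ∀ S : Finset (d → ℤ), ∑ k ∈ S, Real.exp (2 * σ * Real.sqrt (freqNormSq k)) *
      ‖mFourierCoeff (EuclideanSpace.complexify ∘ v) k‖ ^ 2 ≤ C) (S : Finset (d → ℤ)) :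
    ∑ k ∈ S, Real.exp (2 * σ * Real.sqrt (freqNormSq k)) *
      ‖mFourierCoeff (EuclideanSpace.complexify ∘ fun x =>
        v x - Torus.gradient (invLaplacian (divergence v)) x) k‖ ^ 2 ≤ C :=
  gevreyBound_of_norm_le (norm_mFourierCoeff_leray_le hv) h S

end Operators

/-! ### The product law -/

section Convect

variable [DecidableEq d] {σ Cu Cv : ℝ} {u v : UnitAddTorus d → EuclideanSpace ℝ d}

/-- **The Gevrey product law for the convective term** (Foias–Temam 1989, Lemma 2.1; Gevrey classes
are algebras): if `û` and `v̂` have Gevrey bounds of radius `σ > 0` and levels `C_u`, `C_v`, then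
`𝓕((u·∇)v)` has the Gevrey bound of radius `σ/2` and level `(2π d² · (2√C_u Z) · (2√C_v Z))²`,
`Z = ∑ₘ (1 + |m|²) e^{−(σ/2)|m|}`.  Proof: with `γ k = e^{(σ/2)|k|} ‖𝓕((u·∇)v)(k)‖`,
`α m = e^{(σ/2)|m|} ‖û(m)‖`, `β l = e^{(σ/2)|l|} |l| ‖v̂(l)‖`, the convolution bound
`NSGevrey.norm_mFourierCoeff_convect_le` and `|k| ≤ |m| + |k − m|` give `γ k ≤ 2πd² ∑ₘ α m β (k − m)`,
so `T = ∑_{k ∈ S} γ k² ≤ 2πd² ∑_{k∈S} γ k ∑ₘ α m β (k − m) ≤ 2πd² ‖α‖₁ ‖β‖₂ √T`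
(`NSGevrey.sum_mul_tsum_mul_le`), i.e. `T ≤ (2πd² ‖α‖₁ ‖β‖₂)²`; finally `‖α‖₁, ‖β‖₁ ≤ 2√C Z`
(`NSGevrey.summable_exp_mul_one_add_sqrt_mul_norm_of_gevreyBound`) and `‖β‖₂ ≤ ‖β‖₁`.
[cite: FoiasTemam1989, Lemma 2.1] -/
theorem gevreyBound_convect (hσ : 0 < σ) (hu : IsSmooth u) (hv : IsSmooth v)
    (hGu : ∀ S : Finset (d → ℤ), ∑ k ∈ S, Real.exp (2 * σ * Real.sqrt (freqNormSq k)) *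
      ‖mFourierCoeff (EuclideanSpace.complexify ∘ u) k‖ ^ 2 ≤ Cu)
    (hGv : ∀ S : Finset (d → ℤ), ∑ k ∈ S, Real.exp (2 * σ * Real.sqrt (freqNormSq k)) *
      ‖mFourierCoeff (EuclideanSpace.complexify ∘ v) k‖ ^ 2 ≤ Cv) (S : Finset (d → ℤ)) :
    ∑ k ∈ S, Real.exp (2 * (σ / 2) * Real.sqrt (freqNormSq k)) *
        ‖mFourierCoeff (EuclideanSpace.complexify ∘ convect u v) k‖ ^ 2 ≤
      (2 * Real.pi * (Fintype.card d : ℝ) ^ 2 *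
        (2 * Real.sqrt Cu * ∑' m : d → ℤ, (1 + freqNormSq m) ^ 1 * Real.exp (-(σ / 2 * Real.sqrt (freqNormSq m)))) *
        (2 * Real.sqrt Cv * ∑' m : d → ℤ, (1 + freqNormSq m) ^ 1 * Real.exp (-(σ / 2 * Real.sqrt (freqNormSq m))))) ^ 2 := by
  -- notation
  set c₀ : ℝ := 2 * Real.pi * (Fintype.card d : ℝ) ^ 2 with hc₀
  have hc₀0 : 0 ≤ c₀ := by positivity
  set Z : ℝ := ∑' m : d → ℤ, (1 + freqNormSq m) ^ 1 * Real.exp (-(σ / 2 * Real.sqrt (freqNormSq m))) with hZ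
  set U : (d → ℤ) → ℝ := fun m => ‖mFourierCoeff (EuclideanSpace.complexify ∘ u) m‖ with hU
  set W : (d → ℤ) → ℝ := fun m => ‖mFourierCoeff (EuclideanSpace.complexify ∘ v) m‖ with hW
  set e : (d → ℤ) → ℝ := fun m => Real.exp (σ / 2 * Real.sqrt (freqNormSq m)) with he
  have he0 : ∀ m, 0 < e m := fun m => Real.exp_pos _
  set α : (d → ℤ) → ℝ := fun m => e m * U m with hα
  set β : (d → ℤ) → ℝ := fun l => e l * (Real.sqrt (freqNormSq l) * W l) with hβ
  set γ : (d → ℤ) → ℝ := fun k => e k * ‖mFourierCoeff (EuclideanSpace.complexify ∘ convect u v) k‖ with hγ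
  have hα0 : ∀ m, 0 ≤ α m := fun m => mul_nonneg (he0 m).le (norm_nonneg _)
  have hβ0 : ∀ l, 0 ≤ β l := fun l => mul_nonneg (he0 l).le (mul_nonneg (Real.sqrt_nonneg _) (norm_nonneg _))
  have hγ0 : ∀ k, 0 ≤ γ k := fun k => mul_nonneg (he0 k).le (norm_nonneg _)
  -- the weighted `ℓ¹` bounds at half radius
  set α' : (d → ℤ) → ℝ := fun m => e m * ((1 + Real.sqrt (freqNormSq m)) * U m) with hα'
  set β' : (d → ℤ) → ℝ := fun m => e m * ((1 + Real.sqrt (freqNormSq m)) * W m) with hβ'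
  obtain ⟨hα's, hα'le⟩ := summable_exp_mul_one_add_sqrt_mul_norm_of_gevreyBound hσ hGu
  obtain ⟨hβ's, hβ'le⟩ := summable_exp_mul_one_add_sqrt_mul_norm_of_gevreyBound hσ hGv
  have hαle' : ∀ m, α m ≤ α' m := fun m =>
    mul_le_mul_of_nonneg_left (le_mul_of_one_le_left (norm_nonneg _)
      (le_add_of_nonneg_right (Real.sqrt_nonneg _))) (he0 m).le
  have hβle' : ∀ m, β m ≤ β' m := fun m =>
    mul_le_mul_of_nonneg_left (mul_le_mul_of_nonneg_right
      (le_add_of_nonneg_left zero_le_one) (norm_nonneg _)) (he0 m).le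
  have hαs : Summable α := hα's.of_nonneg_of_le hα0 hαle'
  have hβs : Summable β := hβ's.of_nonneg_of_le hβ0 hβle'
  set A : ℝ := 2 * Real.sqrt Cu * Z with hA
  set B : ℝ := 2 * Real.sqrt Cv * Z with hB
  have hαA : ∑' m, α m ≤ A := (hαs.tsum_le_tsum hαle' hα's).trans hα'le
  have hβB : ∑' m, β m ≤ B := (hβs.tsum_le_tsum hβle' hβ's).trans hβ'le
  have hB0 : 0 ≤ B := (tsum_nonneg hβ0).trans hβB
  -- `β` is square summable with `∑ β² ≤ B²`
  have hβleB : ∀ l, β l ≤ B := fun l => (hβs.le_tsum l fun m _ => hβ0 m).trans hβB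
  have hβ2s : Summable fun l => β l ^ 2 :=
    (hβs.mul_left B).of_nonneg_of_le (fun l => sq_nonneg _) fun l => by
      rw [sq]; exact mul_le_mul_of_nonneg_right (hβleB l) (hβ0 l)
  have hβ2 : ∑' l, β l ^ 2 ≤ B ^ 2 := by
    calc ∑' l, β l ^ 2 ≤ ∑' l, B * β l :=
          hβ2s.tsum_le_tsum (fun l => by rw [sq]; exact mul_le_mul_of_nonneg_right (hβleB l) (hβ0 l))
            (hβs.mul_left B)
      _ = B * ∑' l, β l := tsum_mul_left
      _ ≤ B * B := mul_le_mul_of_nonneg_left hβB hB0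
      _ = B ^ 2 := (sq B).symm
  have hsqrtβ : Real.sqrt (∑' l, β l ^ 2) ≤ B := by
    rw [← Real.sqrt_sq hB0]; exact Real.sqrt_le_sqrt hβ2
  -- Step A: `γ k ≤ c₀ ∑ₘ α m β (k - m)`
  have hstepA : ∀ k, γ k ≤ c₀ * ∑' m, α m * β (k - m) := by
    intro k
    have hmaj := norm_mFourierCoeff_convect_le hu hv k
    have hms := summable_convectMajorant hu hv k
    have hin : Summable fun m => α m * β (k - m) :=
      (hαs.mul_right B).of_nonneg_of_le (fun m => mul_nonneg (hα0 m) (hβ0 _)) fun m =>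
        mul_le_mul_of_nonneg_left (hβleB _) (hα0 m)
    have hsplit : ∀ m, e k ≤ e m * e (k - m) := by
      intro m
      rw [he]; dsimp only
      rw [← Real.exp_add, Real.exp_le_exp, ← mul_add]
      refine mul_le_mul_of_nonneg_left ?_ (by positivity)
      have h := sqrt_freqNormSq_add_le m (k - m)
      rwa [add_sub_cancel] at h
    have hterm : ∀ m, e k * (U m * (Real.sqrt (freqNormSq (k - m)) * W (k - m))) ≤ α m * β (k - m) := by
      intro m
      have hx : 0 ≤ U m * (Real.sqrt (freqNormSq (k - m)) * W (k - m)) :=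
        mul_nonneg (norm_nonneg _) (mul_nonneg (Real.sqrt_nonneg _) (norm_nonneg _))
      calc e k * (U m * (Real.sqrt (freqNormSq (k - m)) * W (k - m)))
          ≤ (e m * e (k - m)) * (U m * (Real.sqrt (freqNormSq (k - m)) * W (k - m))) :=
            mul_le_mul_of_nonneg_right (hsplit m) hx
        _ = α m * β (k - m) := by rw [hα, hβ]; ring
    calc γ k ≤ e k * (c₀ * ∑' m, U m * (Real.sqrt (freqNormSq (k - m)) * W (k - m))) :=
          mul_le_mul_of_nonneg_left hmaj (he0 k).le
      _ = c₀ * ∑' m, e k * (U m * (Real.sqrt (freqNormSq (k - m)) * W (k - m))) := by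
          rw [hms.tsum_mul_left (e k)]; ring
      _ ≤ c₀ * ∑' m, α m * β (k - m) :=
          mul_le_mul_of_nonneg_left ((hms.mul_left (e k)).tsum_le_tsum hterm hin) hc₀0
  -- Step B: `T ≤ c₀ ‖α‖₁ ‖β‖₂ √T`, hence `T ≤ (c₀ A B)²`
  set T : ℝ := ∑ k ∈ S, γ k ^ 2 with hT
  have hT0 : 0 ≤ T := Finset.sum_nonneg fun k _ => sq_nonneg _
  have hTle : T ≤ c₀ * (A * B) * Real.sqrt T := by
    calc T = ∑ k ∈ S, γ k * γ k := Finset.sum_congr rfl fun k _ => sq (γ k)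
      _ ≤ ∑ k ∈ S, γ k * (c₀ * ∑' m, α m * β (k - m)) :=
          Finset.sum_le_sum fun k _ => mul_le_mul_of_nonneg_left (hstepA k) (hγ0 k)
      _ = c₀ * ∑ k ∈ S, γ k * ∑' m, α m * β (k - m) := by
          rw [Finset.mul_sum]; exact Finset.sum_congr rfl fun k _ => by ring
      _ ≤ c₀ * ((∑' m, α m) * Real.sqrt (∑' l, β l ^ 2) * Real.sqrt T) :=
          mul_le_mul_of_nonneg_left (sum_mul_tsum_mul_le S hα0 hβ0 hγ0 hαs hβ2s) hc₀0
      _ ≤ c₀ * (A * B * Real.sqrt T) := by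
          refine mul_le_mul_of_nonneg_left (mul_le_mul_of_nonneg_right ?_ (Real.sqrt_nonneg _)) hc₀0
          exact mul_le_mul hαA hsqrtβ (Real.sqrt_nonneg _) ((tsum_nonneg hα0).trans hαA)
      _ = c₀ * (A * B) * Real.sqrt T := by ring
  have hM0 : 0 ≤ c₀ * (A * B) := mul_nonneg hc₀0 (mul_nonneg ((tsum_nonneg hα0).trans hαA) hB0)
  have hfin : T ≤ (c₀ * (A * B)) ^ 2 := by
    have hs : Real.sqrt T * Real.sqrt T = T := Real.mul_self_sqrt hT0
    have hsq : Real.sqrt T ≤ c₀ * (A * B) := by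
      by_cases h0 : Real.sqrt T = 0
      · rw [h0]; exact hM0
      · have hpos : 0 < Real.sqrt T := lt_of_le_of_ne (Real.sqrt_nonneg _) (Ne.symm h0)
        have := hTle
        rw [← hs] at this
        exact le_of_mul_le_mul_right (by linarith) hpos
    calc T = Real.sqrt T * Real.sqrt T := hs.symm
      _ ≤ (c₀ * (A * B)) * (c₀ * (A * B)) := mul_le_mul hsq hsq (Real.sqrt_nonneg _) hM0
      _ = (c₀ * (A * B)) ^ 2 := (sq _).symm
  -- the weight `e^{2(σ/2)|k|} ‖·‖² = γ k²`
  have hre : ∀ k, Real.exp (2 * (σ / 2) * Real.sqrt (freqNormSq k)) *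
      ‖mFourierCoeff (EuclideanSpace.complexify ∘ convect u v) k‖ ^ 2 = γ k ^ 2 := by
    intro k
    rw [hγ, he]; dsimp only
    rw [mul_pow, sq (Real.exp _), ← Real.exp_add]
    congr 2; ring
  calc ∑ k ∈ S, Real.exp (2 * (σ / 2) * Real.sqrt (freqNormSq k)) *
        ‖mFourierCoeff (EuclideanSpace.complexify ∘ convect u v) k‖ ^ 2 = T :=
        Finset.sum_congr rfl fun k _ => hre k
    _ ≤ (c₀ * (A * B)) ^ 2 := hfin
    _ = (c₀ * A * B) ^ 2 := by ring

end Convect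

end Torus

end Literature.Analysis.FluidPDE

end
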